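import Summits.NavierStokesRegularity.NavierStokesRegularity.Theorems.RellichScarSimilarityCovarianceRotationTypeI
import Summits.NavierStokesRegularity.NavierStokesRegularity.Theorems.SymmetryModuliCountForcedSymmetryClassEquivalence
import Summits.NavierStokesRegularity.NavierStokesRegularity.Theorems.SymmetryModuliCountForcedSymmetryRdssLiouvilleTauReduction
import Literature.Analysis.FluidPDE.LocalTypeIScaling
import Literature.Analysis.FluidPDE.LocalTypeIReverseTools
import Literature.Analysis.FluidPDE.LocalTypeI
import HarnessLib

/-!
# Crux `ForcedSymmetry` (stmt-NavierStokesRegularity-4052), line `recurrent-closing` gen 5, stub 3a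
# `stub_satelliteExclusion`: structural tools (orbit invariance, centre, far-field / isolation forms, `X ⇒ stub`)

Support file (theorems only, `--supports stmt-NavierStokesRegularity-4052`; the same stub is stub 1 of crux
stmt-NavierStokesRegularity-8561's line `birth`).  The stub says: a smooth profile of Albritton–Barker's local Type-I class
on the slab, invariant a.e. under the similarity `(t, x) ↦ l • R⁻¹ w (l² t) (l R x + ξ)` (`l > 1`), is regular at every
final-slice point `(0, y)` other than the centre (`y ≠ l R y + ξ`).  Nothing here proves it (it is an open lemma — gap (iii)
of the printed rungs, Chae–Wolf 2017 Thm 1.1 being the `C_t Lᵖ` model); what is proved is the exact anatomy every attack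
uses:

* `eLpNorm_top_parabolicCylinder_conj` — `‖R⁻¹ w(t, R ·)‖_{L^∞(Q((t₀,y), r))} = ‖w‖_{L^∞(Q((t₀, R y), r))}`;
* `eLpNorm_top_parabolicCylinder_rdss` — under POINTWISE invariance on `t < 0`,
  `‖w‖_{L^∞(Q((0,y), r))} = l ‖w‖_{L^∞(Q((0, l R y + ξ), l r))}` (the similarity maps backward cylinders at the final slice
  onto backward cylinders at the final slice);
* `isBackwardSingularPoint_rdss_iff`, `isBackwardSingularPoint_rdss_iterate_iff` — the final-slice singular set is invariant
  under `φ : y ↦ l R y + ξ` and its iterates (satellites come in whole orbits);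
* `exists_unique_rdssCentre`, `norm_rdss_iterate_sub_centre` — for `l > 1` the similarity has exactly one spatial centre
  `c = l R c + ξ`, and `‖φ^[n] y − c‖ = lⁿ ‖y − c‖`;
* `satelliteExclusion_iff_farField` — satellite exclusion for `w` ⇔ regularity of ALL final-slice points outside some ball
  about the centre ("regularity at spatial infinity on the final slice");
* `satelliteExclusion_iff_isolatedCentre` — ⇔ the centre is an ISOLATED point of the final-slice singular set;
* `satelliteExclusion_of_typeIAncientLiouville` — the route target `X` implies the stub (the stub is at most `X`).

References: D. Chae, J. Wolf, Comm. PDE 42 (2017) = arXiv:1610.09464, Thm 1.1 [ChaeWolf2017RemovingDSS]; D. Albritton,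
T. Barker, JMFM 21 (2019), §1, §3 [AlbrittonBarker2019].
-/

noncomputable section

-- the summit and its single sub-problem share the name (CONVENTIONS §1), as in every Theorems file
set_option linter.dupNamespace false

open MeasureTheory Set Function Metric Filter
open scoped ENNReal
open Literature.Analysis.FluidPDE

namespace Summit.NavierStokesRegularity.NavierStokesRegularity.Theorems.SymmetryModuliCountForcedSymmetry

/-! ### `L^∞` norms on backward cylinders under rotations and under the similarity -/

/-- **Rotations transport `L^∞` norms on backward cylinders**:
`‖R⁻¹ w(t, R x)‖_{L^∞(Q((t₀, y), r))} = ‖w‖_{L^∞(Q((t₀, R y), r))}` (`(t, x) ↦ (t, R x)` preserves Lebesgue measure and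
maps `Q((t₀,y), r)` onto `Q((t₀, R y), r)`; `‖R⁻¹ a‖ = ‖a‖`). [folklore] -/
theorem eLpNorm_top_parabolicCylinder_conj (R : (EuclideanSpace ℝ (Fin 3)) ≃ₗᵢ[ℝ] (EuclideanSpace ℝ (Fin 3))) (r t₀ : ℝ) (y : (EuclideanSpace ℝ (Fin 3))) (w : ℝ → (EuclideanSpace ℝ (Fin 3)) → (EuclideanSpace ℝ (Fin 3))) :
    eLpNorm (uncurry fun t x => R.symm (w t (R x))) ∞ (volume.restrict (parabolicCylinder r ((t₀, y) : ℝ × (EuclideanSpace ℝ (Fin 3))))) =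
      eLpNorm (uncurry w) ∞ (volume.restrict (parabolicCylinder r ((t₀, R y) : ℝ × (EuclideanSpace ℝ (Fin 3))))) := by
  set Ψ : ℝ × (EuclideanSpace ℝ (Fin 3)) → ℝ × (EuclideanSpace ℝ (Fin 3)) := Prod.map (id : ℝ → ℝ) (R : (EuclideanSpace ℝ (Fin 3)) → (EuclideanSpace ℝ (Fin 3))) with hΨ
  have hΨmp : MeasurePreserving Ψ (volume : Measure (ℝ × (EuclideanSpace ℝ (Fin 3)))) volume :=
    measurePreserving_prodMap_id_linearIsometryEquiv R
  have hΨemb : MeasurableEmbedding Ψ := measurableEmbedding_prodMap_id_linearIsometryEquiv R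
  have hQ : Ψ ⁻¹' parabolicCylinder r ((t₀, R y) : ℝ × (EuclideanSpace ℝ (Fin 3))) = parabolicCylinder r ((t₀, y) : ℝ × (EuclideanSpace ℝ (Fin 3))) := by
    have h := RellichScarSimilarityCovariance.preimage_prodMap_parabolicCylinder R.symm r ((t₀, y) : ℝ × (EuclideanSpace ℝ (Fin 3)))
    simpa [hΨ] using h
  have h1 : eLpNorm (uncurry fun t x => R.symm (w t (R x))) ∞
      (volume.restrict (parabolicCylinder r ((t₀, y) : ℝ × (EuclideanSpace ℝ (Fin 3))))) =
      eLpNorm (uncurry w ∘ Ψ) ∞ (volume.restrict (parabolicCylinder r ((t₀, y) : ℝ × (EuclideanSpace ℝ (Fin 3))))) :=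
    eLpNorm_congr_norm_ae (ae_of_all _ fun z => by simp [hΨ, uncurry])
  rw [h1, ← hΨemb.eLpNorm_map_measure, ← hQ, ← hΨemb.restrict_map, hΨmp.map_eq]

/-- **The similarity transports `L^∞` norms on final-slice backward cylinders.**  If
`l • R⁻¹ w (l² t) (l R x + ξ) = w t x` for all `t < 0` and all `x` (`l > 0`), then for every `y` and `r`,
`‖w‖_{L^∞(Q((0,y), r))} = l · ‖w‖_{L^∞(Q((0, l R y + ξ), l r))}`: on `Q((0,y), r) ⊆ {t < 0}` the field `w` coincides with
the zoom `l • u₁(l² t, R⁻¹ξ + l x)` of the conjugate `u₁ = R⁻¹ w(·, R ·)`, and zooms/rotations transport the norms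
(`eLpNorm_top_nsZoom`, `eLpNorm_top_parabolicCylinder_conj`). [folklore] -/
theorem eLpNorm_top_parabolicCylinder_rdss {w : ℝ → (EuclideanSpace ℝ (Fin 3)) → (EuclideanSpace ℝ (Fin 3))} {l : ℝ} (R : (EuclideanSpace ℝ (Fin 3)) ≃ₗᵢ[ℝ] (EuclideanSpace ℝ (Fin 3))) (ξ : (EuclideanSpace ℝ (Fin 3))) (hl : 0 < l)
    (hinv : ∀ t < (0 : ℝ), ∀ x : (EuclideanSpace ℝ (Fin 3)), l • R.symm (w (l ^ 2 * t) (l • R x + ξ)) = w t x) (r : ℝ) (y : (EuclideanSpace ℝ (Fin 3))) :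
    eLpNorm (uncurry w) ∞ (volume.restrict (parabolicCylinder r (((0 : ℝ), y) : ℝ × (EuclideanSpace ℝ (Fin 3))))) =
      ENNReal.ofReal l *
        eLpNorm (uncurry w) ∞ (volume.restrict (parabolicCylinder (l * r) (((0 : ℝ), l • R y + ξ) : ℝ × (EuclideanSpace ℝ (Fin 3))))) := by
  -- the conjugate `u₁ = R⁻¹ w(·, R ·)` and its zoom `F = l • u₁(l² t, R⁻¹ ξ + l x)`
  set u₁ : ℝ → (EuclideanSpace ℝ (Fin 3)) → (EuclideanSpace ℝ (Fin 3)) := fun t x => R.symm (w t (R x)) with hu₁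
  have hF : ∀ z ∈ parabolicCylinder r (((0 : ℝ), y) : ℝ × (EuclideanSpace ℝ (Fin 3))),
      uncurry w z = uncurry (l • stPull (l ^ 2) l 0 (R.symm ξ) u₁) z := by
    rintro ⟨t, x⟩ hz
    rw [mem_parabolicCylinder] at hz
    have ht : t < 0 := by simpa using hz.1.2
    have hR : R (R.symm ξ + l • x) = l • R x + ξ := by
      rw [map_add, LinearIsometryEquiv.apply_symm_apply, map_smul, add_comm]
    simp only [uncurry_apply_pair, Pi.smul_apply, stPull_apply, hu₁, zero_add, hR]
    exact (hinv t ht x).symm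
  have hcongr : eLpNorm (uncurry w) ∞ (volume.restrict (parabolicCylinder r (((0 : ℝ), y) : ℝ × (EuclideanSpace ℝ (Fin 3))))) =
      eLpNorm (uncurry (l • stPull (l ^ 2) l 0 (R.symm ξ) u₁)) ∞
        (volume.restrict (parabolicCylinder r (((0 : ℝ), y) : ℝ × (EuclideanSpace ℝ (Fin 3))))) :=
    eLpNorm_congr_ae (ae_restrict_of_forall_mem (isOpen_parabolicCylinder r _).measurableSet hF)
  rw [hcongr, eLpNorm_top_nsZoom hl 0 (R.symm ξ) r (((0 : ℝ), y) : ℝ × (EuclideanSpace ℝ (Fin 3))) u₁]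
  have hst : stAffine (l ^ 2) l 0 (R.symm ξ) (((0 : ℝ), y) : ℝ × (EuclideanSpace ℝ (Fin 3))) = ((0 : ℝ), R.symm ξ + l • y) := by
    simp [stAffine]
  rw [hst, hu₁, eLpNorm_top_parabolicCylinder_conj R (l * r) 0 (R.symm ξ + l • y) w]
  congr 3
  rw [map_add, LinearIsometryEquiv.apply_symm_apply, map_smul, add_comm]

/-! ### The final-slice singular set is invariant under the similarity -/

/-- **Satellites come in orbits.**  Under pointwise invariance on `t < 0` (`l > 0`), the final-slice point `(0, y)` is a
backward singular point iff `(0, l R y + ξ)` is. [folklore] -/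
theorem isBackwardSingularPoint_rdss_iff {w : ℝ → (EuclideanSpace ℝ (Fin 3)) → (EuclideanSpace ℝ (Fin 3))} {l : ℝ} (R : (EuclideanSpace ℝ (Fin 3)) ≃ₗᵢ[ℝ] (EuclideanSpace ℝ (Fin 3))) (ξ : (EuclideanSpace ℝ (Fin 3))) (hl : 0 < l)
    (hinv : ∀ t < (0 : ℝ), ∀ x : (EuclideanSpace ℝ (Fin 3)), l • R.symm (w (l ^ 2 * t) (l • R x + ξ)) = w t x) (y : (EuclideanSpace ℝ (Fin 3))) :
    IsBackwardSingularPoint w ((0 : ℝ), y) ↔ IsBackwardSingularPoint w ((0 : ℝ), l • R y + ξ) := by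
  have hl0 : ENNReal.ofReal l ≠ 0 := (ENNReal.ofReal_pos.2 hl).ne'
  constructor
  · intro h ρ hρ
    have key := eLpNorm_top_parabolicCylinder_rdss R ξ hl hinv (ρ / l) y
    rw [mul_div_cancel₀ _ hl.ne', h (ρ / l) (div_pos hρ hl)] at key
    exact ((ENNReal.mul_eq_top.1 key.symm).resolve_right fun h' => ENNReal.ofReal_ne_top h'.1).2
  · intro h r hr
    rw [eLpNorm_top_parabolicCylinder_rdss R ξ hl hinv r y, h (l * r) (mul_pos hl hr)]
    exact ENNReal.mul_top hl0

/-- Iterated form: `(0, y)` is backward singular iff `(0, φ^[n] y)` is, `φ y = l R y + ξ`. [folklore] -/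
theorem isBackwardSingularPoint_rdss_iterate_iff {w : ℝ → (EuclideanSpace ℝ (Fin 3)) → (EuclideanSpace ℝ (Fin 3))} {l : ℝ} (R : (EuclideanSpace ℝ (Fin 3)) ≃ₗᵢ[ℝ] (EuclideanSpace ℝ (Fin 3))) (ξ : (EuclideanSpace ℝ (Fin 3)))
    (hl : 0 < l) (hinv : ∀ t < (0 : ℝ), ∀ x : (EuclideanSpace ℝ (Fin 3)), l • R.symm (w (l ^ 2 * t) (l • R x + ξ)) = w t x)
    (n : ℕ) (y : (EuclideanSpace ℝ (Fin 3))) :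
    IsBackwardSingularPoint w ((0 : ℝ), y) ↔
      IsBackwardSingularPoint w ((0 : ℝ), (fun y : (EuclideanSpace ℝ (Fin 3)) => l • R y + ξ)^[n] y) := by
  induction n generalizing y with
  | zero => simp
  | succ n ih =>
    rw [Function.iterate_succ_apply, ← ih (l • R y + ξ)]
    exact isBackwardSingularPoint_rdss_iff R ξ hl hinv y

/-! ### The centre of the similarity -/

/-- **The spatial centre.**  For `l > 1` the affine map `y ↦ l R y + ξ` has exactly one fixed point (`id − l R` is an
injective, hence bijective, endomorphism of `(EuclideanSpace ℝ (Fin 3))`: `‖l R x‖ = l ‖x‖`). [folklore] -/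
theorem exists_unique_rdssCentre {l : ℝ} (hl : 1 < l) (R : (EuclideanSpace ℝ (Fin 3)) ≃ₗᵢ[ℝ] (EuclideanSpace ℝ (Fin 3))) (ξ : (EuclideanSpace ℝ (Fin 3))) :
    ∃! c : (EuclideanSpace ℝ (Fin 3)), c = l • R c + ξ := by
  set f : (EuclideanSpace ℝ (Fin 3)) →ₗ[ℝ] (EuclideanSpace ℝ (Fin 3)) := LinearMap.id - l • (R.toLinearEquiv : (EuclideanSpace ℝ (Fin 3)) →ₗ[ℝ] (EuclideanSpace ℝ (Fin 3))) with hf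
  have hfap : ∀ x : (EuclideanSpace ℝ (Fin 3)), f x = x - l • R x := fun x => by simp [hf]
  have hinj : Function.Injective f := by
    rw [← LinearMap.ker_eq_bot, LinearMap.ker_eq_bot']
    intro x hx
    rw [hfap, sub_eq_zero] at hx
    have hn : ‖x‖ = l * ‖x‖ := by
      conv_lhs => rw [hx]
      rw [norm_smul, LinearIsometryEquiv.norm_map, Real.norm_of_nonneg (zero_le_one.trans hl.le)]
    have : (l - 1) * ‖x‖ = 0 := by linarith
    rcases mul_eq_zero.1 this with h | h
    · linarith
    · exact norm_eq_zero.1 h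
  have hsurj : Function.Surjective f := LinearMap.surjective_of_injective hinj
  obtain ⟨c, hc⟩ := hsurj ξ
  rw [hfap] at hc
  refine ⟨c, ?_, fun c' hc' => hinj ?_⟩
  · show c = l • R c + ξ
    rw [← hc]
    abel
  · have hc'' : c' = l • R c' + ξ := hc'
    rw [hfap, hfap, hc, sub_eq_iff_eq_add, add_comm]
    exact hc''

/-- Distances to the centre scale by `l` along the orbit: `‖φ^[n] y − c‖ = lⁿ ‖y − c‖`. [folklore] -/
theorem norm_rdss_iterate_sub_centre {l : ℝ} (hl : 0 ≤ l) (R : (EuclideanSpace ℝ (Fin 3)) ≃ₗᵢ[ℝ] (EuclideanSpace ℝ (Fin 3))) (ξ : (EuclideanSpace ℝ (Fin 3))) {c : (EuclideanSpace ℝ (Fin 3))}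
    (hc : c = l • R c + ξ) (n : ℕ) (y : (EuclideanSpace ℝ (Fin 3))) :
    ‖(fun y : (EuclideanSpace ℝ (Fin 3)) => l • R y + ξ)^[n] y - c‖ = l ^ n * ‖y - c‖ := by
  induction n generalizing y with
  | zero => simp
  | succ n ih =>
    rw [Function.iterate_succ_apply, ih, pow_succ]
    have h : l • R y + ξ - c = l • R (y - c) := by
      conv_lhs => rw [hc]
      rw [map_sub, smul_sub]
      abel
    rw [h, norm_smul, LinearIsometryEquiv.norm_map, Real.norm_of_nonneg hl]
    ring

/-- The inverse similarity on the final slice: `φ (ψ y) = y` for `ψ y = R⁻¹ (l⁻¹ (y − ξ))`, `l ≠ 0`. [folklore] -/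
theorem rdss_apply_inverse {l : ℝ} (hl : l ≠ 0) (R : (EuclideanSpace ℝ (Fin 3)) ≃ₗᵢ[ℝ] (EuclideanSpace ℝ (Fin 3))) (ξ y : (EuclideanSpace ℝ (Fin 3))) :
    l • R (R.symm (l⁻¹ • (y - ξ))) + ξ = y := by
  rw [LinearIsometryEquiv.apply_symm_apply, smul_inv_smul₀ hl, sub_add_cancel]

/-- Iterated inverse: `φ^[n] (ψ^[n] y) = y`. [folklore] -/
theorem rdss_iterate_apply_inverse_iterate {l : ℝ} (hl : l ≠ 0) (R : (EuclideanSpace ℝ (Fin 3)) ≃ₗᵢ[ℝ] (EuclideanSpace ℝ (Fin 3))) (ξ : (EuclideanSpace ℝ (Fin 3))) (n : ℕ) (y : (EuclideanSpace ℝ (Fin 3))) :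
    (fun y : (EuclideanSpace ℝ (Fin 3)) => l • R y + ξ)^[n] ((fun y : (EuclideanSpace ℝ (Fin 3)) => R.symm (l⁻¹ • (y - ξ)))^[n] y) = y := by
  induction n generalizing y with
  | zero => simp
  | succ n ih =>
    rw [Function.iterate_succ_apply' (fun y : (EuclideanSpace ℝ (Fin 3)) => R.symm (l⁻¹ • (y - ξ))), Function.iterate_succ_apply, 
      rdss_apply_inverse hl, ih]

/-- Distances to the centre contract by `l⁻¹` along the inverse orbit: `‖ψ^[n] y − c‖ = l⁻ⁿ ‖y − c‖`. [folklore] -/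
theorem norm_rdss_inverse_iterate_sub_centre {l : ℝ} (hl : 0 < l) (R : (EuclideanSpace ℝ (Fin 3)) ≃ₗᵢ[ℝ] (EuclideanSpace ℝ (Fin 3))) (ξ : (EuclideanSpace ℝ (Fin 3))) {c : (EuclideanSpace ℝ (Fin 3))}
    (hc : c = l • R c + ξ) (n : ℕ) (y : (EuclideanSpace ℝ (Fin 3))) :
    ‖(fun y : (EuclideanSpace ℝ (Fin 3)) => R.symm (l⁻¹ • (y - ξ)))^[n] y - c‖ = (l ^ n)⁻¹ * ‖y - c‖ := by
  have key := norm_rdss_iterate_sub_centre hl.le R ξ hc n ((fun y : (EuclideanSpace ℝ (Fin 3)) => R.symm (l⁻¹ • (y - ξ)))^[n] y)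
  rw [rdss_iterate_apply_inverse_iterate hl.ne' R ξ n y] at key
  rw [key, ← mul_assoc, inv_mul_cancel₀ (pow_ne_zero n hl.ne'), one_mul]

/-! ### Two equivalent forms of satellite exclusion for a given profile -/

/-- **Satellite exclusion = regularity at spatial infinity on the final slice.**  Under pointwise invariance on `t < 0`
with `l > 1` and centre `c = l R c + ξ`: every final-slice point other than the centre is regular iff every final-slice
point outside SOME ball about the centre is regular (push a point out along its orbit, `‖φ^[n] y − c‖ = lⁿ‖y − c‖ → ∞`,
and pull regularity back by orbit invariance). [folklore] -/
theorem satelliteExclusion_iff_farField {w : ℝ → (EuclideanSpace ℝ (Fin 3)) → (EuclideanSpace ℝ (Fin 3))} {l : ℝ} (R : (EuclideanSpace ℝ (Fin 3)) ≃ₗᵢ[ℝ] (EuclideanSpace ℝ (Fin 3))) (ξ : (EuclideanSpace ℝ (Fin 3))) (hl : 1 < l)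
    (hinv : ∀ t < (0 : ℝ), ∀ x : (EuclideanSpace ℝ (Fin 3)), l • R.symm (w (l ^ 2 * t) (l • R x + ξ)) = w t x) {c : (EuclideanSpace ℝ (Fin 3))}
    (hc : c = l • R c + ξ) :
    (∀ y : (EuclideanSpace ℝ (Fin 3)), y ≠ l • R y + ξ → ¬ IsBackwardSingularPoint w ((0 : ℝ), y)) ↔
      ∃ ρ : ℝ, ∀ y : (EuclideanSpace ℝ (Fin 3)), ρ ≤ ‖y - c‖ → ¬ IsBackwardSingularPoint w ((0 : ℝ), y) := by
  have hl0 : 0 < l := zero_lt_one.trans hl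
  have huniq : ∀ y : (EuclideanSpace ℝ (Fin 3)), y = l • R y + ξ → y = c := fun y hy =>
    (exists_unique_rdssCentre hl R ξ).unique hy hc
  constructor
  · intro h
    refine ⟨1, fun y hy => h y fun hfix => ?_⟩
    have := huniq y hfix
    subst this
    norm_num at hy
  · rintro ⟨ρ, hρ⟩ y hy hsing
    have hyc : 0 < ‖y - c‖ := by
      rw [norm_pos_iff, sub_ne_zero]
      intro h
      exact hy (h ▸ hc)
    obtain ⟨n, hn⟩ : ∃ n : ℕ, ρ / ‖y - c‖ < l ^ n := pow_unbounded_of_one_lt _ hl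
    have hfar : ρ ≤ ‖(fun y : (EuclideanSpace ℝ (Fin 3)) => l • R y + ξ)^[n] y - c‖ := by
      rw [norm_rdss_iterate_sub_centre hl0.le R ξ hc n y]
      exact ((div_lt_iff₀ hyc).1 hn).le
    exact hρ _ hfar ((isBackwardSingularPoint_rdss_iterate_iff R ξ hl0 hinv n y).1 hsing)

/-- **Satellite exclusion = the centre is isolated in the final-slice singular set.**  Under pointwise invariance on
`t < 0` with `l > 1` and centre `c`: every final-slice point other than the centre is regular iff every final-slice point
of SOME punctured ball about the centre is regular (pull a point in along the inverse orbit,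
`‖ψ^[n] y − c‖ = l⁻ⁿ‖y − c‖ → 0`). [folklore] -/
theorem satelliteExclusion_iff_isolatedCentre {w : ℝ → (EuclideanSpace ℝ (Fin 3)) → (EuclideanSpace ℝ (Fin 3))} {l : ℝ} (R : (EuclideanSpace ℝ (Fin 3)) ≃ₗᵢ[ℝ] (EuclideanSpace ℝ (Fin 3))) (ξ : (EuclideanSpace ℝ (Fin 3))) (hl : 1 < l)
    (hinv : ∀ t < (0 : ℝ), ∀ x : (EuclideanSpace ℝ (Fin 3)), l • R.symm (w (l ^ 2 * t) (l • R x + ξ)) = w t x) {c : (EuclideanSpace ℝ (Fin 3))}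
    (hc : c = l • R c + ξ) :
    (∀ y : (EuclideanSpace ℝ (Fin 3)), y ≠ l • R y + ξ → ¬ IsBackwardSingularPoint w ((0 : ℝ), y)) ↔
      ∃ ρ : ℝ, 0 < ρ ∧ ∀ y : (EuclideanSpace ℝ (Fin 3)), y ≠ c → ‖y - c‖ < ρ → ¬ IsBackwardSingularPoint w ((0 : ℝ), y) := by
  have hl0 : 0 < l := zero_lt_one.trans hl
  have huniq : ∀ y : (EuclideanSpace ℝ (Fin 3)), y = l • R y + ξ → y = c := fun y hy =>
    (exists_unique_rdssCentre hl R ξ).unique hy hc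
  constructor
  · intro h
    exact ⟨1, one_pos, fun y hy _ => h y fun hfix => hy (huniq y hfix)⟩
  · rintro ⟨ρ, hρ, h⟩ y hy hsing
    have hyc : 0 < ‖y - c‖ := by
      rw [norm_pos_iff, sub_ne_zero]
      intro h'
      exact hy (h' ▸ hc)
    obtain ⟨n, hn⟩ : ∃ n : ℕ, ‖y - c‖ / ρ < l ^ n := pow_unbounded_of_one_lt _ hl
    set y' : (EuclideanSpace ℝ (Fin 3)) := (fun y : (EuclideanSpace ℝ (Fin 3)) => R.symm (l⁻¹ • (y - ξ)))^[n] y with hy'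
    have hnorm : ‖y' - c‖ = (l ^ n)⁻¹ * ‖y - c‖ := norm_rdss_inverse_iterate_sub_centre hl0 R ξ hc n y
    have hpow : 0 < l ^ n := pow_pos hl0 n
    have hy'c : y' ≠ c := by
      intro h'
      have : ‖y' - c‖ = 0 := by rw [h', sub_self, norm_zero]
      rw [hnorm] at this
      rcases mul_eq_zero.1 this with h1 | h1
      · exact (inv_ne_zero hpow.ne') h1
      · exact hyc.ne' h1
    have hclose : ‖y' - c‖ < ρ := by
      rw [hnorm, inv_mul_lt_iff₀ hpow]
      rw [div_lt_iff₀ hρ] at hn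
      linarith [hn]
    have hsing' : IsBackwardSingularPoint w ((0 : ℝ), y') := by
      rw [isBackwardSingularPoint_rdss_iterate_iff R ξ hl0 hinv n y', hy',
        rdss_iterate_apply_inverse_iterate hl0.ne' R ξ n y]
      exact hsing
    exact h y' hy'c hclose hsing'

/-! ### The stub is at most `X` -/

/-- **`X ⇒ stub_satelliteExclusion`.**  Under the route target `TypeIAncientLiouville` every slab profile of the class is
a.e. zero (its KNSS-mild representative vanishes), so EVERY final-slice point is regular — in particular the satellite
statement holds (verbatim the registered signature of `stub_satelliteExclusion`, behind the hypothesis `X`).  Certificate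
that the open lemma is not harder than the node. [cite: AlbrittonBarker2019, §3] -/
theorem satelliteExclusion_of_typeIAncientLiouville
    (hX : Summit.NavierStokesRegularity.NavierStokesRegularity.Theses.SymmetryModuliCount.TypeIAncientLiouville) :
    ∀ (w : ℝ → (EuclideanSpace ℝ (Fin 3)) → (EuclideanSpace ℝ (Fin 3))) (q : ℝ → (EuclideanSpace ℝ (Fin 3)) → ℝ) (H : ℝ → (EuclideanSpace ℝ (Fin 3)) → (EuclideanSpace ℝ (Fin 3)) →L[ℝ] (EuclideanSpace ℝ (Fin 3))) (C : ℝ),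
      IsSuitableWeakSolutionOn (slab (EuclideanSpace ℝ (Fin 3)) (Set.Iio 0) isOpen_Iio) 1 0 w q →
      HasWeakSpatialGradientOn (slab (EuclideanSpace ℝ (Fin 3)) (Set.Iio 0) isOpen_Iio) w H →
      typeIBound (Set.Iio (0 : ℝ) ×ˢ Set.univ) w q H < ⊤ →
      HasTypeITimeDecay C w →
      IsClassicalNSSolutionOn (Set.Iio 0) 1 0 w q →
      ∀ (l : ℝ) (R : (EuclideanSpace ℝ (Fin 3)) ≃ₗᵢ[ℝ] (EuclideanSpace ℝ (Fin 3))) (ξ : (EuclideanSpace ℝ (Fin 3))), 1 < l →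
        (fun z : ℝ × (EuclideanSpace ℝ (Fin 3)) => l • R.symm (w (l ^ 2 * z.1) (l • R z.2 + ξ)))
          =ᵐ[volume.restrict (Set.Iio (0 : ℝ) ×ˢ Set.univ)] (fun z : ℝ × (EuclideanSpace ℝ (Fin 3)) => w z.1 z.2) →
        ∀ y : (EuclideanSpace ℝ (Fin 3)), y ≠ l • R y + ξ → ¬ IsBackwardSingularPoint w ((0 : ℝ), y) := by
  intro w q H C hsw _hwg hI hdec _hcl l R ξ _hl _hinv y _hy hsing
  obtain ⟨v, hv, hae⟩ := exists_isTypeIAncientMild_repr_of_slabProfile hsw hdec hI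
  have hzero : ∀ t < 0, ∀ x, v t x = 0 := hX C v (isTypeIAncientMild_iff.1 hv)
  have hw0 : ∀ᵐ z ∂(volume.restrict (Iio (0 : ℝ) ×ˢ (univ : Set (EuclideanSpace ℝ (Fin 3))))),
      uncurry w z = (0 : ℝ × (EuclideanSpace ℝ (Fin 3)) → (EuclideanSpace ℝ (Fin 3))) z := by
    filter_upwards [hae, ae_restrict_mem (measurableSet_Iio.prod MeasurableSet.univ)] with z hz hmem
    rw [hz]
    exact hzero z.1 hmem.1 z.2
  have hsub : parabolicCylinder 1 (((0 : ℝ), y) : ℝ × (EuclideanSpace ℝ (Fin 3))) ⊆ Iio (0 : ℝ) ×ˢ (univ : Set (EuclideanSpace ℝ (Fin 3))) :=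
    parabolicCylinder_subset_lowerHalf le_rfl 1
  have h1 := hsing 1 one_pos
  rw [eLpNorm_congr_ae (ae_restrict_of_ae_restrict_of_subset hsub hw0), eLpNorm_zero] at h1
  exact ENNReal.zero_ne_top h1

end Summit.NavierStokesRegularity.NavierStokesRegularity.Theorems.SymmetryModuliCountForcedSymmetry

end
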